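import Literature.NumberTheory.LFunctions.ExplicitLeastPrimeNonExceptionalModuli
import Literature.NumberTheory.LFunctions.ExplicitExceptionalZeroBoundsEvenDerivative
import Literature.NumberTheory.LFunctions.NoRealZeroUpTo
import Literature.NumberTheory.LFunctions.SiegelTheorem
import Literature.NumberTheory.LFunctions.LogIntegral
import Mathlib.NumberTheory.PrimeCounting
import Mathlib.NumberTheory.LSeries.PrimesInAP
import HarnessLib

/-!
# Explicit prime number theorems in arithmetic progressions for every modulus `q ≥ 3`
# (Bennett–Martin–O'Bryant–Rechnitzer 2018, §1: Theorems 1.1–1.3, Corollaries 1.6–1.8, Theorem 1.9,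
# Propositions 1.10–1.11)

Topic `Literature/NumberTheory/LFunctions`; namespace `Literature.NumberTheory.LFunctions.BMOR2018`
(continuing `ExplicitPNTNonExceptionalModuli.lean` (Lemma 6.12, `ψ`), `ExplicitLeastPrimeNonExceptionalModuli.lean`
(Lemma 6.12, `θ`), `CertifiedRangeDirichletZeroFreeRegion.lean` (Definition 3.1, Proposition 4.34) and
`ExplicitExceptionalZeroBoundsRealCharacters.lean` (Lemma 6.3)). NAMED FACTS AS PRINTED (`def … : Prop`,
D-0014: published, refereed, not reproved here — the proofs are the paper's explicit analytic machinery plus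
months of certified computation), three small definitions with bodies (`c₀`, `x₀`, `x₂` — the paper's
piecewise constants (1.10), (1.11), (1.18) — and `nthPrimeMod`, the paper's `p_n(q,a)`), and THEOREMS:
the instrument-provenance discharge of Proposition 1.11, the `q ≥ 4·10⁵` half of Proposition 1.10, the
envelope/existential equivalence for Theorem 1.1, and the explicit least-prime consequence of Corollary 1.6.

## Source and version (first-hand)

M. A. Bennett, G. Martin, K. O'Bryant, A. Rechnitzer, *Explicit bounds for primes in arithmetic
progressions*, Illinois J. Math. **62** (2018), no. 1–4, 427–532 (doi:10.1215/ijm/1552442669)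
[BennettMartinOBryantRechnitzer2018]. TEXT = arXiv:1802.00085**v3** (27 Nov 2018; arXiv comment: «We
implemented an improvement in the method in Section 2 (which produces the bound ν(q)), resulting in a change
to most of the constants in our theorems. To appear in Illinois J. Math.»; e-print sha256 `72352427a2f8…`,
`EBPAP.tex` sha256 `2a709b83d08c…`), which is also the hub's held corpus text `paper:arxiv-1802.00085`
(checked constant by constant). CAUTION: arXiv **v1** (31 Jan 2018) prints DIFFERENT constants in Theorem 1.1
(`c_ψ(q) ≤ q/(3600 φ(q))`, `x₀(q) = 7.94·10⁹ / 4.81·10¹²/q / exp(0.036 √q log³ q)`); everything below is the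
accepted (v3 = journal) text. Numbering: theorems by section (`\newtheorem{theorem}{Theorem}[section]`),
equations by section; the journal PAGE numbers inside 427–532 are not asserted (publisher pdf not held).
The authors' data site `http://www.nt.math.ubc.ca/BeMaObRe/` («Updated manuscript», 20 Nov 2018; tables
`c_all_rounded.txt` sha256 `ce5d6788…`, `x0-xm-xe.txt`) carries the per-modulus constants `c_ψ(q)`, `c_θ(q)`,
`c_π(q)`, `x_ψ(q)`, `x_θ(q)`, `x_π(q)` for `3 ≤ q ≤ 10⁵` that Theorems 1.1–1.3 assert to exist.

## What the source prints (§1, verbatim) and how it is rendered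

Notation (1.4)–(1.6): `Li(x) = ∫₂ˣ dt/log t`; `θ(x;q,a) = ∑_{p ≤ x, p ≡ a (q)} log p`,
`ψ(x;q,a) = ∑_{pⁿ ≤ x, pⁿ ≡ a (q)} log p`, `π(x;q,a) = #{p ≤ x : p ≡ a (q)}`, for «relatively prime positive
integers `a` and `q`». RENDERING (the tree's vocabulary, nothing new): `ψ(x;q,a)` =
`Sieve.ParityWave0.chebyshevPsiMod q a x`, `θ(x;q,a)` = `Sieve.BFIReduction.thetaMod q a x`, `π(x;q,a)` =
`Sieve.BFIReduction.piMod q a x` (real-valued count), `Li` = `offsetLogIntegral` (`LogIntegral.lean`, the same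
`∫₂ˣ dt/log t`), `π(x)` = `Nat.primeCounting ⌊x⌋₊`; «`a` coprime to `q`» = `a : (ZMod q)ˣ` (exactly the reduced
classes; the convention of `lemma612_psi`); `φ(q)` = `q.totient`; `log` = `Real.log`.

* **Theorem 1.1** (ψ), **1.2** (θ), **1.3** (π): «Let `q ≥ 3` be an integer and let `a` be an integer that
  is coprime to `q`. There exist explicit positive constants `c_ψ(q)` and `x_ψ(q)` such that
  `|ψ(x;q,a) − x/φ(q)| < c_ψ(q) x/log x` for all `x ≥ x_ψ(q)` (1.9). Moreover, `c_ψ(q)` and `x_ψ(q)` satisfy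
  `c_ψ(q) ≤ c₀(q)` and `x_ψ(q) ≤ x₀(q)`, where `c₀(q) = 1/840` if `3 ≤ q ≤ 10⁴`, `1/160` if `q > 10⁴` (1.10),
  and `x₀(q) = 8·10⁹` if `3 ≤ q ≤ 10⁵`, `exp(0.03 √q log³ q)` if `q > 10⁵` (1.11).» — 1.2 the same for
  `|θ(x;q,a) − x/φ(q)| < c_θ(q) x/log x` (1.12), 1.3 for `|π(x;q,a) − Li(x)/φ(q)| < c_π(q) x/log² x` (1.13).
  TYPED in the ENVELOPE form «for all `x ≥ x₀(q)`, `|…| < c₀(q) x/log x`» (`theorem11_psi`, `theorem12_theta`,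
  `theorem13_pi`), which is EQUIVALENT to the printed existential form (`theorem11_psi_iff_exists`: a bound with
  `c ≤ c₀(q)` from `x_ψ ≤ x₀(q)` on gives the envelope since `x/log x ≥ 0` for `x ≥ x₀(q) ≥ 1`; conversely take
  `c_ψ = c₀`, `x_ψ = x₀`). The per-modulus constants live in the authors' data files, not in print; the one
  printed per-modulus INEQUALITY, (1.14) «`|θ(x;3,a) − x/2| < 4.015·10⁻⁴ x/log x` for all `x ≥ 7,932,309,757`»,
  is typed (`display114_theta_mod_three`); the §1 table of `c_ψ(q), …, x_π(q)` for `3 ≤ q ≤ 10` is QUOTED below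
  but not typed as inequalities (print does not state the rounding direction of the tabulated `c`'s).
* (1.15) «`|π(x) − Li(x)| < 0.0008375 x/log² x` for all `x ≥ 1,474,279,333`» («an almost immediate consequence
  of Theorem 1.3 … for `q = 3` and … routine computations (Appendix A.8)») — `display115_primeCounting_sub_li`.
* **Theorems 1.4 / 1.5** («Suppose that `c_π(q)φ(q) < 1`. Then for `x > x_π(q)` (1.16)
  `x/(φ(q) log x) < π(x;q,a) < (x/(φ(q) log x))(1 + 5/(2 log x))`»; «either `p_n(q,a) ≤ x_π(q)` or (1.17)
  `nφ(q) log(nφ(q)) < p_n(q,a) < nφ(q)(log(nφ(q)) + (4/3) log log(nφ(q)))`») are NOT typed as separate facts: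
  their hypothesis and threshold are the data-file constants `c_π(q)`, `x_π(q)` of Theorem 1.3 (and the proofs,
  §5.3, use `x_π(q) ≥ x_π(99 989) = 14 735`); their printed EXPLICIT version is **Corollary 1.6**, typed:
  «Let `1 ≤ q ≤ 1200` be an integer, and let `a` be an integer that is coprime to `q`. • For all `x ≥ 50q²`,
  we have `x/(φ(q) log x) < π(x;q,a) < (x/(φ(q) log x))(1 + 5/(2 log x))`. • For all positive integers `n`
  such that `p_n(q,a) ≥ 22q²`, we have `nφ(q) log(nφ(q)) < p_n(q,a) < nφ(q)(log(nφ(q)) + (4/3) log log(nφ(q)))`.»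
  (`corollary16`; `p_n(q,a)` = «the `n`th smallest prime that is congruent to `a` modulo `q`» = `nthPrimeMod q a
  (n − 1)`, 0-indexed `Nat.nth`).
* **Corollary 1.7**: «Let `a` and `q` be integers with `1 ≤ q ≤ 10⁵` and `gcd(a,q) = 1`. If `x ≥ 10³`, then
  `|ψ(x;q,a) − x/φ(q)| < 0.19 x/log x`, `|θ(x;q,a) − x/φ(q)| < 0.40 x/log x`, `|π(x;q,a) − Li(x)/φ(q)| <
  0.53 x/log² x`. Moreover, if `x ≥ 10⁶`, then … `< 0.011 x/log x`, `< 0.024 x/log x`, `< 0.027 x/log² x`.»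
* **Corollary 1.8**: «Let `a` and `q` be integers with `q ≥ 3` and `gcd(a,q) = 1`. Suppose that
  `x ≥ exp(8 √q log³ q)`. Then `max{|ψ(x;q,a) − x/φ(q)|, |θ(x;q,a) − x/φ(q)|} < (1/160) x/log x` and
  `|π(x;q,a) − Li(x)/φ(q)| < (1/160) x/log² x`.» (Remark before it, not typed: «for `q ≥ 58` we can weaken the
  restriction on `x` to `x ≥ exp(0.03 √q log³ q)`».)
* **Theorem 1.9**: «Let `q` and `a` be integers with `1 ≤ q ≤ 10⁵` and `gcd(a,q) = 1`, and suppose that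
  `x ≤ x₂(q)`, where (1.18) `x₂(q) = 10¹²` if `q = 1`; `x₂(q/2)` if `q ≡ 2 (mod 4)`; `4·10¹³` if `q ∈ {3,4,5}`;
  `10¹³` if `5 < q ≤ 100`, `q ≢ 2 (mod 4)`; `10¹²` if `100 < q ≤ 10⁴`, `q ≢ 2 (mod 4)`; `10¹¹` if
  `10⁴ < q ≤ 10⁵`, `q ≢ 2 (mod 4)`. We have `max_{1 ≤ y ≤ x} |ψ(y;q,a) − y/φ(q)| ≤ 1.745 √x`,
  `max_{1 ≤ y ≤ x} |θ(y;q,a) − y/φ(q)| ≤ 2.072 √x` and `max_{1 ≤ y ≤ x} |π(y;q,a) − Li(y)/φ(q)| ≤ 2.734 √x/log x`.»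
  TYPING NOTE (edge of the domain, not an erratum of substance): with the paper's own `Li(y) = ∫₂ʸ dt/log t`
  (1.4), `Li(y) → −∞` as `y → 1⁺`, so the `π`-clause cannot hold literally down to `y = 1`; it is typed on
  `2 ≤ y ≤ x` (where the computation of Appendix A.3 lives), the `ψ`- and `θ`-clauses on `1 ≤ y ≤ x` as printed.
  A `max` over `[1,x]` bounded by `B` is rendered «for every `y` with `1 ≤ y ≤ x`, `|…| ≤ B`».
* **Proposition 1.10**: «If `χ` is a primitive quadratic character with conductor `q > 6677`, then
  `L(1,χ) > 12/√q`.» (`proposition110`; rendered on `Re L(1,χ) = L(1,χ)` as in `bmor2018_lemma63`.)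
  PROVED here for `q ≥ 4·10⁵` modulo Watkins' Table 4 (`proposition110_of_watkins_of_ge`, from the kernel floor
  `√q L(1,χ) ≥ log(q − 4) > 12` for even `χ` and `h(−q) ≥ 46` for odd `χ`); the window `6677 < q < 4·10⁵`
  is the Sage computation of Appendix A.10 (untyped).
* **Proposition 1.11**: «Let `q ≥ 3` be an integer, and let `χ` be a quadratic character modulo `q`. If
  `β > 0` is a real number for which `L(β,χ) = 0`, then `β ≤ 1 − 40/(√q log² q)`.» (`proposition111`;
  «quadratic» = real non-principal, `IsQuadratic ∧ χ ≠ 1`; imprimitive characters included, as the printed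
  proof's last paragraph treats them.) **DISCHARGED modulo the instrument base** (`proposition111_of_watkins_platt`):
  the printed proof (§6.1; arXiv v3 `EBPAP.tex` l. 2630 ff.) is «If `q ≤ 4·10⁵`, Platt's computations confirm that no quadratic
  character modulo `q` has a nontrivial real zero … Assume now that `q > 4·10⁵` …» — in the tree:
  `noRealZeroUpTo_platt` (`platt2016_theorem71 ∧ platt2016_theorem72`) below `4·10⁵`, and above it the STRONGER
  `β < 1 − 100/(√q log² q)` of `BGTZ2025.realZero_lt_hundred_of_watkins_platt` (Bordignon's route, modulo
  `watkins2004_theorem`, `watkins2004_table4`, `platt2016_theorem71`); the paper's own route above `4·10⁵`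
  (Lemma 6.3 + the `L′`-bound `0.27356 log² q` of its FLM-type lemma) is not needed.
* **Proposition 1.12** («`|b(χ)| ≤ 0.2515 q log q` for `q ≥ 10⁵`», `b(χ)` the constant term of `L′/L(s,χ)` at
  `s = 0`) — NOT typed (an internal constant of the §6.2 machinery; no consumer).
* The §1 table (between (1.13) and (1.14); the authors' `c_all_rounded.txt` / `x0-xm-xe.txt` agree):
  `q : c_ψ, c_θ, c_π, x_ψ, x_θ, x_π` = `3 : 0.0003964, 0.0004015, 0.0004187, 576470759, 7932309757, 7940618683`;
  `4 : 0.0004770, 0.0004822, 0.0005028, 952930663, 4800162889, 5438260589`; `5 : 0.0003665, 0.0003716, 0.0003876,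
  1333804249, 3374890111, 3375517771`; `6 : = row 3 but x_ψ = 576470831`; `7 : 0.0004584, 0.0004657, 0.0004857,
  686060664, 1765650541, 1765715753`; `8 : 0.0005742, 0.0005840, 0.0006091, 603874695, 2261078657, 2265738169`;
  `9 : 0.0005048, 0.0005122, 0.0005342, 415839496, 929636413, 929852953`; `10 : = row 5`.

## Instrument provenance (why this file sits in the real-character column)

§1 (after (1.18)): «The main ingredients involved include explicit zero-free regions for Dirichlet
`L`-functions by Kadiri [Ka] and McCurley [Mc3], explicit estimates for the zero-counting function for Dirichlet
`L`-functions by Trudgian [Tru], and the results of large-scale computations of Platt [Pla2], all of which we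
cite from the literature.» For `3 ≤ q ≤ 10⁵` the proofs run under Hypothesis Z(10⁸/q, 5.6) — the tree's
`BMOR2018.proposition434`, DERIVED in `CertifiedRangeDirichletZeroFreeRegion.lean` from the named facts
`platt2016_theorem71` (Platt, Math. Comp. 85 (2016) Thm 7.1), `kadiri2018_theorem11` (Kadiri, Mathematika 64
(2018) Thm 1.1) and `platt_trudgian_numerical_rh`; for `q > 10⁵` they use McCurley's region (`McCurley1984_theorem1`,
`R₁ = 9.645908801`), Proposition 1.11 (discharged here modulo Watkins + Platt) and Lemma 6.3 (`bmor2018_lemma63`,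
modulo `watkins2004_table4`). So every fact below is a CONSUMER of the column's instrument base; none is in
the cone of a Summits statement.

## Contents

* defs `c₀`, `x₀`, `x₂`, `nthPrimeMod` (+ `nthPrimeMod_spec`);
* named facts `theorem11_psi`, `theorem12_theta`, `theorem13_pi`, `display114_theta_mod_three`,
  `display115_primeCounting_sub_li`, `corollary16`, `corollary17`, `corollary18`, `theorem19`, `proposition110`,
  `proposition111`;
* theorems `theorem11_psi_iff_exists`, `exists_prime_le_of_corollary16` (`p(q,a) ≤ 50q²` for `q ≤ 1200`),
  `proposition110_of_watkins_of_ge`, `proposition111_of_watkins_platt`; appended: `c₀_le`, `x₀_le_exp_of_four_le`,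
  `corollary18_of_theorems_of_four_le` (Corollary 1.8 ⇐ Theorems 1.1–1.3 for every `q ≥ 4`; only `q = 3` rests on
  the computation below `x₀(3)`), `exists_prime_le_of_corollary17` (every `q ≤ 10⁵`: a prime `p ≡ a (mod q)` with
  `p ≤ max(10⁶, e^{φ(q)/40})`).

## References

* M. A. Bennett, G. Martin, K. O'Bryant, A. Rechnitzer, Illinois J. Math. 62 (2018) 427–532, §1
  (Theorems 1.1–1.5, 1.9, Corollaries 1.6–1.8, Propositions 1.10–1.12, displays (1.9)–(1.18)), §5.3, §6.1,
  Appendix A. [BennettMartinOBryantRechnitzer2018]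
* D. J. Platt, Math. Comp. 85 (2016) 3009–3027, Theorems 7.1, 7.2. [Platt2016GRH]
* H. Kadiri, Mathematika 64 (2018) 445–474, Theorem 1.1. [Kadiri2018]
* K. S. McCurley, J. Number Theory 19 (1984) 7–32, Theorem 1. [McCurley1984ZFR]
* M. Watkins, Math. Comp. 73 (2004) 907–938, Table 4. [Watkins2004ClassNumbers]
-/

noncomputable section

open Complex Finset Literature.Barriers.Parity
open Literature.NumberTheory.Sieve Literature.NumberTheory.Sieve.BFIReduction

namespace Literature.NumberTheory.LFunctions

namespace BMOR2018

/-! ### The printed piecewise constants -/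

/-- `c₀(q) = 1/840` if `3 ≤ q ≤ 10⁴`, `1/160` if `q > 10⁴` — display (1.10) (extended by the first branch
below `q = 3`, where the paper makes no statement). [cite: BennettMartinOBryantRechnitzer2018, Theorem 1.1 (1.10)] -/
def c₀ (q : ℕ) : ℝ := if q ≤ 10 ^ 4 then 1 / 840 else 1 / 160

/-- `x₀(q) = 8·10⁹` if `3 ≤ q ≤ 10⁵`, `exp(0.03 √q log³ q)` if `q > 10⁵` — display (1.11).
[cite: BennettMartinOBryantRechnitzer2018, Theorem 1.1 (1.11)] -/
def x₀ (q : ℕ) : ℝ :=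
  if q ≤ 10 ^ 5 then 8 * 10 ^ 9 else Real.exp (0.03 * Real.sqrt q * Real.log q ^ 3)

/-- The branches of `x₂(q)` (display (1.18)) for `q ≢ 2 (mod 4)`: `10¹²` (`q = 1`), `4·10¹³` (`q ∈ {3,4,5}`;
the value at the unused argument `q = 2` is immaterial), `10¹³` (`5 < q ≤ 100`), `10¹²` (`100 < q ≤ 10⁴`),
`10¹¹` (`10⁴ < q`). [cite: BennettMartinOBryantRechnitzer2018, Theorem 1.9 (1.18)] -/
def x₂aux (q : ℕ) : ℝ :=
  if q = 1 then 10 ^ 12 else if q ≤ 5 then 4 * 10 ^ 13 else if q ≤ 100 then 10 ^ 13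
    else if q ≤ 10 ^ 4 then 10 ^ 12 else 10 ^ 11

/-- `x₂(q)` of display (1.18): `x₂(q/2)` if `q ≡ 2 (mod 4)` (then `q/2` is odd, so one unfolding suffices),
otherwise the branch value `x₂aux q`. [cite: BennettMartinOBryantRechnitzer2018, Theorem 1.9 (1.18)] -/
def x₂ (q : ℕ) : ℝ := if q % 4 = 2 then x₂aux (q / 2) else x₂aux q

/-- `c₀(q) > 0`. [cite: BennettMartinOBryantRechnitzer2018, Theorem 1.1 (1.10)] -/
theorem c₀_pos (q : ℕ) : 0 < c₀ q := by
  unfold c₀; split_ifs <;> norm_num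

/-- `x₀(q) ≥ 1` (indeed `≥ 8·10⁹` or `≥ e⁰`). [cite: BennettMartinOBryantRechnitzer2018, Theorem 1.1 (1.11)] -/
theorem one_le_x₀ (q : ℕ) : 1 ≤ x₀ q := by
  unfold x₀; split_ifs
  · norm_num
  · apply Real.one_le_exp
    have h1 : 0 ≤ Real.sqrt q := Real.sqrt_nonneg _
    have h2 : 0 ≤ Real.log q := Real.log_natCast_nonneg q
    positivity

/-- Sample values of (1.18): `x₂(1) = x₂(2) = 10¹²`, `x₂(3) = x₂(4) = x₂(6) = 4·10¹³`, `x₂(7) = 10¹³`,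
`x₂(202) = x₂(101) = 10¹²`, `x₂(10⁵) = 10¹¹`. [cite: BennettMartinOBryantRechnitzer2018, Theorem 1.9 (1.18)] -/
theorem x₂_samples : x₂ 1 = 10 ^ 12 ∧ x₂ 2 = 10 ^ 12 ∧ x₂ 3 = 4 * 10 ^ 13 ∧ x₂ 4 = 4 * 10 ^ 13 ∧
    x₂ 6 = 4 * 10 ^ 13 ∧ x₂ 7 = 10 ^ 13 ∧ x₂ 202 = 10 ^ 12 ∧ x₂ (10 ^ 5) = 10 ^ 11 := by
  refine ⟨?_, ?_, ?_, ?_, ?_, ?_, ?_, ?_⟩ <;> norm_num [x₂, x₂aux]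

/-- `p_n(q,a)`: «the `n`th smallest prime that is congruent to `a` modulo `q`» (§1, before Theorem 1.4), as
Mathlib's 0-indexed `Nat.nth`: `nthPrimeMod q a n` is the `(n+1)`-st such prime.
[cite: BennettMartinOBryantRechnitzer2018, §1 (before Theorem 1.4)] -/
def nthPrimeMod (q : ℕ) (a : ZMod q) (n : ℕ) : ℕ := Nat.nth (fun p : ℕ ↦ p.Prime ∧ (p : ZMod q) = a) n

/-- For a reduced class `a` the progression holds infinitely many primes (Dirichlet; Mathlib), so every
`nthPrimeMod q a n` is a prime `≡ a (mod q)` — the well-definedness of the paper's `p_n(q,a)` for `gcd(a,q) = 1`.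
[cite: BennettMartinOBryantRechnitzer2018, §1 (before Theorem 1.4)] -/
theorem nthPrimeMod_spec {q : ℕ} [NeZero q] {a : ZMod q} (ha : IsUnit a) (n : ℕ) :
    (nthPrimeMod q a n).Prime ∧ ((nthPrimeMod q a n : ℕ) : ZMod q) = a :=
  Nat.nth_mem_of_infinite (p := fun p : ℕ ↦ p.Prime ∧ (p : ZMod q) = a)
    (Nat.infinite_setOf_prime_and_eq_mod ha) n

/-- `nthPrimeMod` is strictly increasing in `n` (`p_1(q,a) < p_2(q,a) < ⋯`).
[cite: BennettMartinOBryantRechnitzer2018, §1 (before Theorem 1.4)] -/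
theorem nthPrimeMod_strictMono {q : ℕ} [NeZero q] {a : ZMod q} (ha : IsUnit a) :
    StrictMono (nthPrimeMod q a) :=
  Nat.nth_strictMono (Nat.infinite_setOf_prime_and_eq_mod ha)

/-! ### Theorems 1.1–1.3 (all moduli `q ≥ 3`) -/

/-- **Bennett–Martin–O'Bryant–Rechnitzer 2018, Theorem 1.1 (as printed):** «Let `q ≥ 3` be an integer and let
`a` be an integer that is coprime to `q`. There exist explicit positive constants `c_ψ(q)` and `x_ψ(q)` such that
`|ψ(x;q,a) − x/φ(q)| < c_ψ(q) x/log x` for all `x ≥ x_ψ(q)`. Moreover, `c_ψ(q)` and `x_ψ(q)` satisfy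
`c_ψ(q) ≤ c₀(q)` and `x_ψ(q) ≤ x₀(q)`» with `c₀`, `x₀` of (1.10)–(1.11). Typed in the equivalent ENVELOPE form
(`theorem11_psi_iff_exists`): for every `q ≥ 3`, every reduced class `a` and every `x ≥ x₀(q)`,
`|ψ(x;q,a) − x/φ(q)| < c₀(q)·x/log x`. For `q ≤ 10⁵` the proof runs under Hypothesis Z(10⁸/q, 5.6)
(`BMOR2018.proposition434` ⇐ Platt 2016 Thm 7.1 + Kadiri 2018 Thm 1.1) plus the computations of Appendix A;
for `q > 10⁵` under McCurley's region, Proposition 1.11 and Lemma 6.3 (Corollary 6.17, `c = 1/160`,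
`x ≥ exp(0.03 √q log³ q)`). Not reproved here. [cite: BennettMartinOBryantRechnitzer2018, Theorem 1.1] -/
def theorem11_psi : Prop :=
  ∀ (q : ℕ) [NeZero q], 3 ≤ q → ∀ (a : (ZMod q)ˣ) (x : ℝ), x₀ q ≤ x →
    |ParityWave0.chebyshevPsiMod q a x - x / q.totient| < c₀ q * x / Real.log x

/-- **Bennett–Martin–O'Bryant–Rechnitzer 2018, Theorem 1.2 (as printed):** «Let `q ≥ 3` be an integer and let
`a` be an integer that is coprime to `q`. There exist explicit positive constants `c_θ(q)` and `x_θ(q)` such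
that `|θ(x;q,a) − x/φ(q)| < c_θ(q) x/log x` for all `x ≥ x_θ(q)`. Moreover, `c_θ(q) ≤ c₀(q)` and
`x_θ(q) ≤ x₀(q)`» (envelope form, as for `theorem11_psi`; `θ` = `BFIReduction.thetaMod`).
[cite: BennettMartinOBryantRechnitzer2018, Theorem 1.2] -/
def theorem12_theta : Prop :=
  ∀ (q : ℕ) [NeZero q], 3 ≤ q → ∀ (a : (ZMod q)ˣ) (x : ℝ), x₀ q ≤ x →
    |thetaMod q (a : ZMod q) x - x / q.totient| < c₀ q * x / Real.log x

/-- **Bennett–Martin–O'Bryant–Rechnitzer 2018, Theorem 1.3 (as printed):** «Let `q ≥ 3` be an integer and let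
`a` be an integer that is coprime to `q`. There exist explicit positive constants `c_π(q)` and `x_π(q)` such
that `|π(x;q,a) − Li(x)/φ(q)| < c_π(q) x/(log x)²` for all `x ≥ x_π(q)`. Moreover, `c_π(q) ≤ c₀(q)` and
`x_π(q) ≤ x₀(q)`» (envelope form; `π(x;q,a)` = `BFIReduction.piMod`, `Li` = `offsetLogIntegral = ∫₂ˣ dt/log t`
= the paper's (1.4)). [cite: BennettMartinOBryantRechnitzer2018, Theorem 1.3] -/
def theorem13_pi : Prop :=
  ∀ (q : ℕ) [NeZero q], 3 ≤ q → ∀ (a : (ZMod q)ˣ) (x : ℝ), x₀ q ≤ x →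
    |piMod q (a : ZMod q) x - offsetLogIntegral x / q.totient| < c₀ q * x / Real.log x ^ 2

/-- **The existential form printed in Theorem 1.1 is equivalent to the typed envelope form**: constants
`0 < c_ψ ≤ c₀(q)`, `0 < x_ψ ≤ x₀(q)` with the bound from `x_ψ` on give the bound with `c₀(q)` from `x₀(q)` on
(`x/log x ≥ 0` there, as `x₀(q) ≥ 1`), and conversely `c_ψ = c₀(q)`, `x_ψ = x₀(q)` will do.
[cite: BennettMartinOBryantRechnitzer2018, Theorem 1.1] -/
theorem theorem11_psi_iff_exists : theorem11_psi ↔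
    ∀ (q : ℕ) [NeZero q], 3 ≤ q → ∀ a : (ZMod q)ˣ, ∃ c X : ℝ, 0 < c ∧ c ≤ c₀ q ∧ 0 < X ∧ X ≤ x₀ q ∧
      ∀ x : ℝ, X ≤ x → |ParityWave0.chebyshevPsiMod q a x - x / q.totient| < c * x / Real.log x := by
  constructor
  · intro h q _ hq a
    exact ⟨c₀ q, x₀ q, c₀_pos q, le_rfl, lt_of_lt_of_le one_pos (one_le_x₀ q), le_rfl,
      fun x hx ↦ h q hq a x hx⟩
  · intro h q _ hq a x hx
    obtain ⟨c, X, _, hcle, _, hXle, hb⟩ := h q hq a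
    have h1 : 1 ≤ x := le_trans (one_le_x₀ q) hx
    have hlog : 0 ≤ Real.log x := Real.log_nonneg h1
    have hquot : 0 ≤ x / Real.log x := div_nonneg (by linarith) hlog
    have hmono : c * x / Real.log x ≤ c₀ q * x / Real.log x := by
      rw [mul_div_assoc, mul_div_assoc]
      exact mul_le_mul_of_nonneg_right hcle hquot
    exact lt_of_lt_of_le (hb x (le_trans hXle hx)) hmono

/-! ### The two displayed numerical consequences (1.14), (1.15) -/

/-- **Display (1.14):** «in case `q = 3` and `a ∈ {1,2}`, Theorem 1.2, using the true values of `c_θ(3)` and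
`x_θ(3)` …, yields the inequality `|θ(x;3,a) − x/2| < 4.015·10⁻⁴ x/log x` for all `x ≥ 7,932,309,757`», and
«`x ≥ 7,932,309,757` is the best-possible range of validity». (`φ(3) = 2`; the two reduced classes are the units
of `ZMod 3`.) [cite: BennettMartinOBryantRechnitzer2018, §1 display (1.14)] -/
def display114_theta_mod_three : Prop :=
  ∀ (a : (ZMod 3)ˣ) (x : ℝ), 7932309757 ≤ x →
    |thetaMod 3 (a : ZMod 3) x - x / 2| < 4.015e-4 * x / Real.log x

/-- **Display (1.15):** «An almost immediate consequence of Theorem 1.3, just from applying the result for `q = 3`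
and performing some routine computations (see Appendix A.8 for details), is that
`|π(x) − Li(x)| < 0.0008375 x/log² x` for all `x ≥ 1,474,279,333`.» (`π(x)` = `Nat.primeCounting ⌊x⌋₊`,
`Li` = `offsetLogIntegral`.) [cite: BennettMartinOBryantRechnitzer2018, §1 display (1.15)] -/
def display115_primeCounting_sub_li : Prop :=
  ∀ x : ℝ, 1474279333 ≤ x →
    |(Nat.primeCounting ⌊x⌋₊ : ℝ) - offsetLogIntegral x| < 0.0008375 * x / Real.log x ^ 2

/-! ### Corollaries 1.6–1.8 and Theorem 1.9 -/

/-- **Bennett–Martin–O'Bryant–Rechnitzer 2018, Corollary 1.6 (as printed):** «Let `1 ≤ q ≤ 1200` be an integer,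
and let `a` be an integer that is coprime to `q`. • For all `x ≥ 50q²`, we have
`x/(φ(q) log x) < π(x;q,a) < (x/(φ(q) log x))(1 + 5/(2 log x))`. • For all positive integers `n` such that
`p_n(q,a) ≥ 22q²`, we have `nφ(q) log(nφ(q)) < p_n(q,a) < nφ(q)(log(nφ(q)) + (4/3) log log(nφ(q)))`.»
(the explicit version of Theorems 1.4/1.5 for `q ≤ 1200`; «The lower bounds `50q²` and `22q²` … simply arise
from fitting envelope functions to the results of routine computations for `x < x_π(q)`»). The positive
integer `n` is written `n + 1` with `p_{n+1}(q,a) = nthPrimeMod q a n`.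
[cite: BennettMartinOBryantRechnitzer2018, Corollary 1.6] -/
def corollary16 : Prop :=
  ∀ (q : ℕ) [NeZero q], 1 ≤ q → q ≤ 1200 → ∀ a : (ZMod q)ˣ,
    (∀ x : ℝ, 50 * (q : ℝ) ^ 2 ≤ x →
      x / (q.totient * Real.log x) < piMod q (a : ZMod q) x ∧
        piMod q (a : ZMod q) x < x / (q.totient * Real.log x) * (1 + 5 / (2 * Real.log x))) ∧
    (∀ n : ℕ, 22 * (q : ℝ) ^ 2 ≤ nthPrimeMod q a n →
      ((n + 1 : ℝ) * q.totient) * Real.log ((n + 1 : ℝ) * q.totient) < nthPrimeMod q a n ∧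
        (nthPrimeMod q a n : ℝ) <
          ((n + 1 : ℝ) * q.totient) * (Real.log ((n + 1 : ℝ) * q.totient) +
            4 / 3 * Real.log (Real.log ((n + 1 : ℝ) * q.totient))))

/-- **Bennett–Martin–O'Bryant–Rechnitzer 2018, Corollary 1.7 (as printed):** «Let `a` and `q` be integers with
`1 ≤ q ≤ 10⁵` and `gcd(a,q) = 1`. If `x ≥ 10³`, then `|ψ(x;q,a) − x/φ(q)| < 0.19 x/log x`,
`|θ(x;q,a) − x/φ(q)| < 0.40 x/log x`, `|π(x;q,a) − Li(x)/φ(q)| < 0.53 x/log² x`. Moreover, if `x ≥ 10⁶`, then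
`|ψ(x;q,a) − x/φ(q)| < 0.011 x/log x`, `|θ(x;q,a) − x/φ(q)| < 0.024 x/log x`,
`|π(x;q,a) − Li(x)/φ(q)| < 0.027 x/log² x`.» (§1: computations of Appendix A.8 below `x₀(q)` combined with
Theorems 1.1–1.3.) [cite: BennettMartinOBryantRechnitzer2018, Corollary 1.7] -/
def corollary17 : Prop :=
  ∀ (q : ℕ) [NeZero q], 1 ≤ q → q ≤ 10 ^ 5 → ∀ (a : (ZMod q)ˣ) (x : ℝ),
    (10 ^ 3 ≤ x →
      |ParityWave0.chebyshevPsiMod q a x - x / q.totient| < 0.19 * x / Real.log x ∧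
      |thetaMod q (a : ZMod q) x - x / q.totient| < 0.40 * x / Real.log x ∧
      |piMod q (a : ZMod q) x - offsetLogIntegral x / q.totient| < 0.53 * x / Real.log x ^ 2) ∧
    (10 ^ 6 ≤ x →
      |ParityWave0.chebyshevPsiMod q a x - x / q.totient| < 0.011 * x / Real.log x ∧
      |thetaMod q (a : ZMod q) x - x / q.totient| < 0.024 * x / Real.log x ∧
      |piMod q (a : ZMod q) x - offsetLogIntegral x / q.totient| < 0.027 * x / Real.log x ^ 2)

/-- **Bennett–Martin–O'Bryant–Rechnitzer 2018, Corollary 1.8 (as printed):** «Let `a` and `q` be integers with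
`q ≥ 3` and `gcd(a,q) = 1`. Suppose that `x ≥ exp(8 √q log³ q)`. Then
`max{|ψ(x;q,a) − x/φ(q)|, |θ(x;q,a) − x/φ(q)|} < (1/160) x/log x` and `|π(x;q,a) − Li(x)/φ(q)| < (1/160) x/log² x`.»
(the `max` rendered as both inequalities). [cite: BennettMartinOBryantRechnitzer2018, Corollary 1.8] -/
def corollary18 : Prop :=
  ∀ (q : ℕ) [NeZero q], 3 ≤ q → ∀ (a : (ZMod q)ˣ) (x : ℝ),
    Real.exp (8 * Real.sqrt q * Real.log q ^ 3) ≤ x →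
      |ParityWave0.chebyshevPsiMod q a x - x / q.totient| < 1 / 160 * x / Real.log x ∧
      |thetaMod q (a : ZMod q) x - x / q.totient| < 1 / 160 * x / Real.log x ∧
      |piMod q (a : ZMod q) x - offsetLogIntegral x / q.totient| < 1 / 160 * x / Real.log x ^ 2

/-- **Bennett–Martin–O'Bryant–Rechnitzer 2018, Theorem 1.9 (as printed):** «Let `q` and `a` be integers with
`1 ≤ q ≤ 10⁵` and `gcd(a,q) = 1`, and suppose that `x ≤ x₂(q)` [display (1.18), `x₂`]. We have
`max_{1 ≤ y ≤ x} |ψ(y;q,a) − y/φ(q)| ≤ 1.745 √x`, `max_{1 ≤ y ≤ x} |θ(y;q,a) − y/φ(q)| ≤ 2.072 √x` and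
`max_{1 ≤ y ≤ x} |π(y;q,a) − Li(y)/φ(q)| ≤ 2.734 √x/log x`.» («summarizing our computations for "small" values
of the parameter `x` (and extending and generalizing Theorem 2 of Ramaré and Rumely)»; Appendix A.3.)
TYPING NOTE: the `π`-clause is typed for `2 ≤ y ≤ x` — with `Li(y) = ∫₂ʸ dt/log t` (the paper's (1.4))
`Li(y) → −∞` as `y → 1⁺`, so the printed range `1 ≤ y` cannot be meant literally there; `ψ`, `θ` on
`1 ≤ y ≤ x` as printed. [cite: BennettMartinOBryantRechnitzer2018, Theorem 1.9] -/
def theorem19 : Prop :=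
  ∀ (q : ℕ) [NeZero q], 1 ≤ q → q ≤ 10 ^ 5 → ∀ (a : (ZMod q)ˣ) (x y : ℝ), 1 ≤ y → y ≤ x → x ≤ x₂ q →
    |ParityWave0.chebyshevPsiMod q a y - y / q.totient| ≤ 1.745 * Real.sqrt x ∧
    |thetaMod q (a : ZMod q) y - y / q.totient| ≤ 2.072 * Real.sqrt x ∧
    (2 ≤ y → |piMod q (a : ZMod q) y - offsetLogIntegral y / q.totient| ≤ 2.734 * Real.sqrt x / Real.log x)

/-! ### Propositions 1.10 and 1.11 -/

/-- **Bennett–Martin–O'Bryant–Rechnitzer 2018, Proposition 1.10 (as printed):** «If `χ` is a primitive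
quadratic character with conductor `q > 6677`, then `L(1,χ) > 12/√q`.» («established in Appendix A.10»; for
`q ≥ 4·10⁵` it is Lemma 6.3, i.e. the tree's `bmor2018_lemma63`, and is PROVED below with the strict sign,
`proposition110_of_watkins_of_ge`; the window `6677 < q < 4·10⁵` is the Sage computation `h(√d) log η_d > 12`
of A.10 and is not reproduced.) Rendered on `Re L(1,χ) = L(1,χ)`.
[cite: BennettMartinOBryantRechnitzer2018, Proposition 1.10] -/
def proposition110 : Prop :=
  ∀ (q : ℕ) [NeZero q], 6677 < q → ∀ χ : DirichletCharacter ℂ q, χ.IsPrimitive → χ.IsQuadratic →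
    12 / Real.sqrt q < (χ.LFunction 1).re

/-- **Bennett–Martin–O'Bryant–Rechnitzer 2018, Proposition 1.11 (as printed):** «Let `q ≥ 3` be an integer,
and let `χ` be a quadratic character modulo `q`. If `β > 0` is a real number for which `L(β,χ) = 0`, then
`β ≤ 1 − 40/(√q log² q)`.» («quadratic character» = real non-principal: `IsQuadratic ∧ χ ≠ 1`, imprimitive
included as in the printed proof, §6.1.) DISCHARGED modulo the instrument base: `proposition111_of_watkins_platt`.
[cite: BennettMartinOBryantRechnitzer2018, Proposition 1.11] -/
def proposition111 : Prop :=
  ∀ (q : ℕ) [NeZero q], 3 ≤ q → ∀ χ : DirichletCharacter ℂ q, χ.IsQuadratic → χ ≠ 1 →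
    ∀ β : ℝ, 0 < β → χ.LFunction β = 0 → β ≤ 1 - 40 / (Real.sqrt q * Real.log q ^ 2)

/-! ### Derived theorems -/

/-- **The explicit least prime in a progression for `q ≤ 1200`** (from Corollary 1.6 (i) at `x = 50q²`):
under `corollary16`, for every `1 ≤ q ≤ 1200` and every reduced class `a` there is a prime `p ≡ a (mod q)` with
`p ≤ 50q²` — since `π(50q²;q,a) > 50q²/(φ(q) log(50q²)) > 0`. [cite: BennettMartinOBryantRechnitzer2018, Corollary 1.6] -/
theorem exists_prime_le_of_corollary16 (h : corollary16) {q : ℕ} [NeZero q] (hq1 : 1 ≤ q) (hq : q ≤ 1200)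
    (a : (ZMod q)ˣ) : ∃ p : ℕ, p.Prime ∧ (p : ZMod q) = a ∧ (p : ℝ) ≤ 50 * (q : ℝ) ^ 2 := by
  set x : ℝ := 50 * (q : ℝ) ^ 2 with hxdef
  have hq1R : (1 : ℝ) ≤ q := by exact_mod_cast hq1
  have hx50 : (50 : ℝ) ≤ x := by rw [hxdef]; nlinarith
  have hxpos : 0 < x := by linarith
  have hlog : 0 < Real.log x := Real.log_pos (by linarith)
  have hφ : (0 : ℝ) < q.totient := by exact_mod_cast Nat.totient_pos.mpr (by omega)
  have hmain : 0 < x / (q.totient * Real.log x) := div_pos hxpos (mul_pos hφ hlog)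
  have hpi : 0 < piMod q (a : ZMod q) x := lt_trans hmain ((h q hq1 hq a).1 x le_rfl).1
  -- a positive sum of indicator values has a non-zero term
  have hne : ∃ n ∈ Icc 0 ⌊x⌋₊, primeInd q (a : ZMod q) n ≠ 0 := by
    by_contra hcon
    push Not at hcon
    have : piMod q (a : ZMod q) x = 0 := by
      unfold piMod
      exact Finset.sum_eq_zero hcon
    linarith
  obtain ⟨n, hn, hind⟩ := hne
  have hP : (n : ZMod q) = a ∧ n.Prime := by
    unfold primeInd at hind
    by_contra hc
    exact hind (if_neg hc)
  refine ⟨n, hP.2, hP.1, ?_⟩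
  have hnle : n ≤ ⌊x⌋₊ := (Finset.mem_Icc.mp hn).2
  calc (n : ℝ) ≤ ⌊x⌋₊ := by exact_mod_cast hnle
    _ ≤ x := Nat.floor_le hxpos.le

/-- From a floor `c ≤ √q·‖L(1,χ)‖` with `m < c` to `m/√q < Re L(1,χ)`, for a primitive real `χ` mod `q > 1`
(`L(1,χ)` is real and positive: `Siegel.LFunction_one_re_eq_norm`). [folklore] -/
private theorem re_LFunction_one_gt_of_floor {q : ℕ} [NeZero q] (hq : 1 < q)
    {χ : DirichletCharacter ℂ q} (hprim : χ.IsPrimitive) (hquad : χ.IsQuadratic) {c m : ℝ}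
    (hfloor : c ≤ Real.sqrt q * ‖χ.LFunction 1‖) (hm : m < c) :
    m / Real.sqrt q < (χ.LFunction 1).re := by
  have hqR : (1 : ℝ) < q := by exact_mod_cast hq
  have hS : 0 < Real.sqrt q := Real.sqrt_pos.mpr (by linarith)
  have hχ1 : χ ≠ 1 := by
    intro h1
    rw [DirichletCharacter.isPrimitive_def, h1, DirichletCharacter.conductor_one] at hprim
    omega
  have hsq : χ ^ 2 = 1 := MulChar.isQuadratic_iff_sq_eq_one.mp hquad
  rw [Siegel.LFunction_one_re_eq_norm χ hχ1 hsq]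
  calc m / Real.sqrt q < c / Real.sqrt q := div_lt_div_of_pos_right hm hS
    _ ≤ ‖χ.LFunction 1‖ := by rw [div_le_iff₀ hS, mul_comm]; exact hfloor

/-- `e¹² < 399 996` (`e < 2.7182818286`). [folklore] -/
private theorem exp_twelve_lt : Real.exp (12 : ℝ) < 399996 := by
  have h := Real.exp_one_lt_d9
  have h0 : 0 < Real.exp 1 := Real.exp_pos 1
  have e : Real.exp (12 : ℝ) = Real.exp 1 ^ 12 := by
    rw [← Real.exp_nat_mul]; norm_num
  rw [e]
  have h12 : Real.exp 1 ^ 12 < 2.7182818286 ^ 12 := pow_lt_pow_left₀ h h0.le (by norm_num)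
  have : (2.7182818286 : ℝ) ^ 12 < 399996 := by norm_num
  linarith

/-- **Proposition 1.10 for `q ≥ 4·10⁵`, PROVED modulo Watkins' Table 4** (strict sign included): for a
primitive quadratic `χ` mod `q ≥ 4·10⁵`, `Re L(1,χ) > 12/√q` — even `χ`: the kernel regulator floor
`√q·L(1,χ) ≥ log(q − 4) ≥ log 399 996 > 12` (`RealZeroRepulsion.sqrt_mul_norm_LFunction_one_ge_log_sub_four_of_even`,
no table); odd `χ`: `√q·L(1,χ) ≥ 46π > 12` from `h(−q) ≥ 46` (`Watkins2004.sqrt_mul_norm_LFunction_one_ge_46pi`,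
the fact `watkins2004_table4`). This is Lemma 6.3's range; the window `6677 < q < 4·10⁵` of the proposition is
print-only (Appendix A.10). [cite: BennettMartinOBryantRechnitzer2018, Proposition 1.10 and Lemma 6.3]
[cite: Watkins2004ClassNumbers, Table 4 p. 936] -/
theorem proposition110_of_watkins_of_ge (hW : QuadraticFields.watkins2004_table4) {q : ℕ} [NeZero q]
    (hq : 400000 ≤ q) {χ : DirichletCharacter ℂ q} (hprim : χ.IsPrimitive) (hquad : χ.IsQuadratic) :
    12 / Real.sqrt q < (χ.LFunction 1).re := by
  have hq1 : 1 < q := by omega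
  have hqR : (400000 : ℝ) ≤ q := by exact_mod_cast hq
  rcases χ.even_or_odd with heven | hodd
  · have hkey := RealZeroRepulsion.sqrt_mul_norm_LFunction_one_ge_log_sub_four_of_even hq1 hprim hquad heven
    refine re_LFunction_one_gt_of_floor hq1 hprim hquad hkey ?_
    rw [Real.lt_log_iff_exp_lt (by linarith)]
    have := exp_twelve_lt
    linarith
  · have hkey := Watkins2004.sqrt_mul_norm_LFunction_one_ge_46pi hW hprim hquad hodd (by omega)
    refine re_LFunction_one_gt_of_floor hq1 hprim hquad hkey ?_
    have := Real.pi_gt_three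
    linarith

/-- **Proposition 1.11 DISCHARGED modulo the instrument base `{watkins2004_theorem, watkins2004_table4,
platt2016_theorem71, platt2016_theorem72}`.** The printed proof (§6.1): «If `q ≤ 4·10⁵`, Platt's computations
confirm that no quadratic character modulo `q` has a nontrivial real zero, and so the lemma is vacuously true
for these moduli `q`» — the tree's `noRealZeroUpTo_platt` (`NoRealZeroUpTo 400000`, every quadratic `χ ≠ χ₀`,
imprimitive included, every `σ > 0`); «Assume now that `q > 4·10⁵` …» — there the tree already has the STRONGER
`β < 1 − 100/(√q log² q)` for every real zero `β < 1` of every real `χ ≠ χ₀`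
(`BGTZ2025.realZero_lt_hundred_of_watkins_platt`: Bordignon 2019/2020 Thm 1.3 derived from Watkins' tables and
Platt's range), and `L(β,χ) ≠ 0` for `β ≥ 1` (Mathlib). [cite: BennettMartinOBryantRechnitzer2018, Proposition 1.11 and §6.1]
[cite: Platt2016GRH, Theorems 7.1 and 7.2] [cite: Watkins2004ClassNumbers, Table 4 p. 936] -/
theorem proposition111_of_watkins_platt (hZ : watkins2004_theorem) (hW : QuadraticFields.watkins2004_table4)
    (hP : platt2016_theorem71) (hP2 : platt2016_theorem72) : proposition111 := by
  intro q _ _ χ hquad hχ β hβ0 hz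
  by_cases hq : q ≤ 400000
  · exact absurd hz ((noRealZeroUpTo_platt hP hP2).lfunction_ne_zero hq χ hquad hχ hβ0)
  · push Not at hq
    have hβ1 : β < 1 := by
      by_contra hge
      push Not at hge
      exact DirichletCharacter.LFunction_ne_zero_of_one_le_re χ (Or.inl hχ)
        (by simpa using hge) hz
    have h100 := BGTZ2025.realZero_lt_hundred_of_watkins_platt hZ hW hP hq hquad hχ hβ1 hz
    have hqR : (400000 : ℝ) < q := by exact_mod_cast hq
    have hS : 0 < Real.sqrt q := Real.sqrt_pos.mpr (by linarith)
    have hL : 0 < Real.log q := Real.log_pos (by linarith)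
    have hden : 0 < Real.sqrt q * Real.log q ^ 2 := by positivity
    have h40 : 40 / (Real.sqrt q * Real.log q ^ 2) ≤ 100 / (Real.sqrt q * Real.log q ^ 2) :=
      div_le_div_of_nonneg_right (by norm_num) hden.le
    linarith

/-! ### Appended 2026-08-28 (bis): Corollary 1.8 is Theorems 1.1–1.3 for every `q ≥ 4`

Consistency of the typed §1: for `q ≥ 4` the threshold `exp(8 √q log³ q)` of Corollary 1.8 is at least
`x₀(q)` (`≥ e²³ > 8·10⁹` when `q ≤ 10⁵`, and `≥ exp(0.03 √q log³ q)` beyond) and `c₀(q) ≤ 1/160`, so Corollary 1.8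
follows from Theorems 1.1–1.3 there; only `q = 3` (`exp(8√3 log³ 3) ≈ 9.8·10⁷ < 8·10⁹`) uses the computation
of Appendix A.9 below `x₀(3)` — cf. the paper's remark that for `q ≥ 58` even `x ≥ exp(0.03 √q log³ q)` suffices. -/

/-- `c₀(q) ≤ 1/160`. [cite: BennettMartinOBryantRechnitzer2018, Theorem 1.1 (1.10)] -/
theorem c₀_le (q : ℕ) : c₀ q ≤ 1 / 160 := by
  unfold c₀; split_ifs <;> norm_num

/-- For `q ≥ 4`, `x₀(q) ≤ exp(8 √q log³ q)`: if `q ≤ 10⁵`, `8 √q log³ q ≥ 8·2·(2·0.693)³ > 23` and `e²³ > 8·10⁹`;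
if `q > 10⁵`, `0.03 ≤ 8`. [cite: BennettMartinOBryantRechnitzer2018, Theorem 1.1 (1.11) and Corollary 1.8] -/
theorem x₀_le_exp_of_four_le {q : ℕ} (hq : 4 ≤ q) :
    x₀ q ≤ Real.exp (8 * Real.sqrt q * Real.log q ^ 3) := by
  have hqR : (4 : ℝ) ≤ q := by exact_mod_cast hq
  have hsqrt : 2 ≤ Real.sqrt q := by
    rw [show (2 : ℝ) = Real.sqrt 4 by rw [show (4 : ℝ) = 2 ^ 2 by norm_num, Real.sqrt_sq (by norm_num)]]
    exact Real.sqrt_le_sqrt hqR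
  have hlog2 := Real.log_two_gt_d9
  have hlog : 1.38 ≤ Real.log q := by
    have h4 : Real.log 4 ≤ Real.log q := Real.log_le_log (by norm_num) hqR
    have : Real.log 4 = 2 * Real.log 2 := by
      rw [show (4 : ℝ) = 2 ^ 2 by norm_num, Real.log_pow]; norm_num
    linarith
  have hlog3 : 1.38 ^ 3 ≤ Real.log q ^ 3 := pow_le_pow_left₀ (by norm_num) hlog 3
  have hprod : 23 ≤ 8 * Real.sqrt q * Real.log q ^ 3 := by
    have h0 : 0 ≤ Real.log q ^ 3 := le_trans (by norm_num) hlog3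
    nlinarith
  unfold x₀; split_ifs with h
  · have he := Real.exp_one_gt_d9
    have h23 : Real.exp 23 ≤ Real.exp (8 * Real.sqrt q * Real.log q ^ 3) := Real.exp_le_exp.mpr hprod
    have hpow : (2.7182818283 : ℝ) ^ 23 ≤ Real.exp 1 ^ 23 := pow_le_pow_left₀ (by norm_num) he.le 23
    have he23 : Real.exp 1 ^ 23 = Real.exp 23 := by rw [← Real.exp_nat_mul]; norm_num
    have hnum : (8 * 10 ^ 9 : ℝ) ≤ (2.7182818283 : ℝ) ^ 23 := by norm_num
    linarith
  · apply Real.exp_le_exp.mpr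
    have h0 : 0 ≤ Real.sqrt q * Real.log q ^ 3 := by nlinarith
    nlinarith

/-- **Corollary 1.8 from Theorems 1.1–1.3 for every `q ≥ 4`** (the facts `theorem11_psi`, `theorem12_theta`,
`theorem13_pi`): for `x ≥ exp(8 √q log³ q) ≥ x₀(q)`, `|ψ(x;q,a) − x/φ(q)|, |θ(x;q,a) − x/φ(q)| < c₀(q)·x/log x ≤
x/(160 log x)` and `|π(x;q,a) − Li(x)/φ(q)| < x/(160 log² x)`. [cite: BennettMartinOBryantRechnitzer2018, Corollary 1.8] -/
theorem corollary18_of_theorems_of_four_le (h₁ : theorem11_psi) (h₂ : theorem12_theta) (h₃ : theorem13_pi)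
    {q : ℕ} [NeZero q] (hq : 4 ≤ q) (a : (ZMod q)ˣ) {x : ℝ}
    (hx : Real.exp (8 * Real.sqrt q * Real.log q ^ 3) ≤ x) :
    |ParityWave0.chebyshevPsiMod q a x - x / q.totient| < 1 / 160 * x / Real.log x ∧
    |thetaMod q (a : ZMod q) x - x / q.totient| < 1 / 160 * x / Real.log x ∧
    |piMod q (a : ZMod q) x - offsetLogIntegral x / q.totient| < 1 / 160 * x / Real.log x ^ 2 := by
  have hq3 : 3 ≤ q := by omega
  have hx0 : x₀ q ≤ x := le_trans (x₀_le_exp_of_four_le hq) hx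
  have h1x : 1 ≤ x := le_trans (one_le_x₀ q) hx0
  have hlog : 0 ≤ Real.log x := Real.log_nonneg h1x
  have hquot : 0 ≤ x / Real.log x := div_nonneg (by linarith) hlog
  have hquot2 : 0 ≤ x / Real.log x ^ 2 := div_nonneg (by linarith) (pow_nonneg hlog 2)
  have hc := c₀_le q
  have hm1 : c₀ q * x / Real.log x ≤ 1 / 160 * x / Real.log x := by
    rw [mul_div_assoc, mul_div_assoc]; exact mul_le_mul_of_nonneg_right hc hquot
  have hm2 : c₀ q * x / Real.log x ^ 2 ≤ 1 / 160 * x / Real.log x ^ 2 := by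
    rw [mul_div_assoc, mul_div_assoc]; exact mul_le_mul_of_nonneg_right hc hquot2
  exact ⟨lt_of_lt_of_le (h₁ q hq3 a x hx0) hm1, lt_of_lt_of_le (h₂ q hq3 a x hx0) hm1,
    lt_of_lt_of_le (h₃ q hq3 a x hx0) hm2⟩

/-! ### Appended 2026-08-28 (ter): the least prime in a progression below `10⁵`, explicitly, from Corollary 1.7

The column's explicit least-prime consumer (`LeastPrimeQuasiPolynomial.lean`, from Lemma 6.12) starts at `q = 10⁵`.
Below it, Corollary 1.7 gives at once: for every `1 ≤ q ≤ 10⁵` and every reduced class `a` there is a prime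
`p ≡ a (mod q)` with `p ≤ max(10⁶, e^{φ(q)/40})` — at `x = max(10⁶, e^{φ(q)/40})` one has `log x ≥ φ(q)/40 > 0.024 φ(q)`,
so `θ(x;q,a) > x/φ(q) − 0.024 x/log x > 0`. (For `q ≤ 1200` the bound `50q²` of `exists_prime_le_of_corollary16` is
far better.) -/

/-- A positive `θ(x;q,a)` exhibits a prime `p ≡ a (mod q)` with `p ≤ x`. [folklore] -/
private theorem exists_prime_le_of_thetaMod_pos {q : ℕ} (a : ZMod q) {x : ℝ} (hx : 0 ≤ x)
    (hθ : 0 < thetaMod q a x) : ∃ p : ℕ, p.Prime ∧ (p : ZMod q) = a ∧ (p : ℝ) ≤ x := by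
  have hne : ∃ n ∈ Icc 0 ⌊x⌋₊, Real.log n * primeInd q a n ≠ 0 := by
    by_contra hcon
    push Not at hcon
    have : thetaMod q a x = 0 := by
      unfold thetaMod
      exact Finset.sum_eq_zero hcon
    linarith
  obtain ⟨n, hn, hterm⟩ := hne
  have hind : primeInd q a n ≠ 0 := fun h0 ↦ hterm (by rw [h0, mul_zero])
  have hP : (n : ZMod q) = a ∧ n.Prime := by
    unfold primeInd at hind
    by_contra hc
    exact hind (if_neg hc)
  refine ⟨n, hP.2, hP.1, ?_⟩
  have hnle : n ≤ ⌊x⌋₊ := (Finset.mem_Icc.mp hn).2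
  calc (n : ℝ) ≤ ⌊x⌋₊ := by exact_mod_cast hnle
    _ ≤ x := Nat.floor_le hx

/-- **The least prime in a progression to a modulus `q ≤ 10⁵`, explicitly (from Corollary 1.7):** under
`corollary17`, for every `1 ≤ q ≤ 10⁵` and every reduced class `a` mod `q` there is a prime `p ≡ a (mod q)` with
`p ≤ max(10⁶, exp(φ(q)/40))`. [cite: BennettMartinOBryantRechnitzer2018, Corollary 1.7] -/
theorem exists_prime_le_of_corollary17 (h : corollary17) {q : ℕ} [NeZero q] (hq1 : 1 ≤ q) (hq : q ≤ 10 ^ 5)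
    (a : (ZMod q)ˣ) :
    ∃ p : ℕ, p.Prime ∧ (p : ZMod q) = a ∧ (p : ℝ) ≤ max (10 ^ 6) (Real.exp ((q.totient : ℝ) / 40)) := by
  set x : ℝ := max (10 ^ 6) (Real.exp ((q.totient : ℝ) / 40)) with hxdef
  have hx6 : (10 : ℝ) ^ 6 ≤ x := le_max_left _ _
  have hxpos : 0 < x := lt_of_lt_of_le (by norm_num) hx6
  have hlogpos : 0 < Real.log x := Real.log_pos (by linarith)
  have hφ : (0 : ℝ) < q.totient := by exact_mod_cast Nat.totient_pos.mpr (by omega)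
  have hlogx : (q.totient : ℝ) / 40 ≤ Real.log x := by
    rw [← Real.log_exp ((q.totient : ℝ) / 40)]
    exact Real.log_le_log (Real.exp_pos _) (le_max_right _ _)
  have hkey : 0.024 * x / Real.log x < x / (q.totient : ℝ) := by
    rw [div_lt_div_iff₀ hlogpos hφ]
    nlinarith [mul_pos hxpos hlogpos]
  have hbound := ((h q hq1 hq a x).2 hx6).2.1
  have hθ : 0 < thetaMod q (a : ZMod q) x := by
    have := (abs_lt.mp hbound).1
    linarith
  exact exists_prime_le_of_thetaMod_pos (a : ZMod q) hxpos.le hθ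

end BMOR2018

end Literature.NumberTheory.LFunctions

end
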